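/-
Copyright: cell `pub-ymgap` (HUMAN RULING D-0062), Track A of `YM-PLAN.md`, DAG node N20 (= NE7b); R134 acceleration seat
`pub-ymgap-dag-n20-c` (strategy s1, generation 0), module 5.  Released under the licence of the surrounding project.
-/
import Summits.QuantumFields.YangMills.Theorems.BalabanUVNodesN20LCSLoopEnergiesEven
import Literature.MathematicalPhysics.QuantumFieldTheory.TorusLoopReflection
import HarnessLib

/-!
# YM-DAG node N20 (= NE7b), strategy s1, module 5: the PEIERLS CONSEQUENCE at scale 1 — a prescribed set of LARGE coarse plaquettes of
# the decimated field (large Wilson loops) is jointly exponentially rare in `β`, per coarse plaquette, uniformly in the volume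
# («pointwise extraction × local conditional stability ⇒ class display», `LocalConditionalStability.sum_admS_integral_le_of_LCS`'s
# mechanism, at the first decimated level of the bare Wilson measure)

Track A of `YM-PLAN.md` (cell `pub-ymgap`, HUMAN RULING D-0062), node **N20** = spine estimate NE7b (`T4WeightBudget.RelWeightBound` —
the cell `pub-balaban`'s OWN estimate, NOT PRINTED in [Bałaban 1983–89], NOT PROVED).  Seat `pub-ymgap-dag-n20-c` (R134, s1), module 5
(modules 1–4: `…N20LCSPushforward` p453912, `…N20LCSLoopEnergies` p455890, `…N20LCSAtTStepOfRecord` p456203, `…N20LCSLoopEnergiesEven`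
p456841).  Kernel theorems only: 0 `def`, 0 `sorry`, standard axioms; COUNT-NEUTRAL; `--supports` the K3 item `SpineGivenEndpointR11`
(stmt-QuantumFields-19676).  Nothing of Bałaban's is asserted or instantiated.

WHY.  On row NE7b the two halves of «LCS-j» (`PointwiseExtraction` = Chebyshev against the sacrificed action part, `LocCondStability` = its
conditional moment) are consumed through the Peierls bookkeeping «extracted cost beats the stability volume cost»
(`…NE7b.LocalConditionalStability.sum_admS_integral_le_of_LCS`).  Modules 2 ∕ 4 prove the stability half UNCONDITIONALLY for Wilson-loop ∕
decimation-square energies (local exponential moments, β-uniform).  THIS FILE draws the Peierls consequence at the first decimated level, in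
probability form — the scale-1 analogue of the tree's rung-0 large-field sparseness
(`…LatticeGapOnTrajectory.SparseDefectOrbitWindow.largeFieldSparse`: «a prescribed set of ε₀-large plaquettes is jointly exponentially rare in β»):
Chebyshev (`exp(δβε·#Q) ≤ exp(δβ·Σ_P A_P)` on the event) × the loop-energy moment bound × Markov.

WHAT IS PROVED ([folklore]; `r` a faithful continuous unitary lattice representation of a compact `G`; energies `A(g) = N − Re tr r(g)`):
* §1 measurability of loop energies (`measurable_loopEnergy`, by the tree's `TorusLoopReflection.entryMeasurable_lineHolonomy ∕ _inv`) and the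
  Markov–Chebyshev step
  **`measureReal_forall_le_le_of_expMoment`**: for a probability measure, `μ{∀P∈Q, ε ≤ A_P} ≤ (∫ e^{δβΣ_P A_P}) · e^{−δβε·#Q}` (`δ, β ≥ 0`).
* §2 **`coarseLargeFieldSparse_loops`** (odd four-tori `(ℤ∕(2S+1))⁴`, `β ≥ 4`): for every finite family of rectangular loops as in module 2
  (`R_P, T_P ≤ 2S+1`, area `≤ 𝔞`, regions `⊇` faces of size `≤ n`, multiplicity `≤ m`, `m·δ·𝔞 ≤ 1∕12`) and every threshold `ε`:
  `μ_β{U | ∀ P ∈ Q, ε ≤ A(hol ∂P)} ≤ exp(((C∕12)·n − δ·β·ε)·#Q)` — for `β > Cn∕(12δε)` a per-loop exponential rate, uniformly in the volume;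
  **`coarseLargeFieldSparse_blockSquares`** (the `b × b` DECIMATION squares: `≤ exp(((C∕12)·b² − δβε)·#Q)`, `m·δ·b² ≤ 1∕12`).
* §3 **`coarseLargeFieldSparse_blockSquares_even01`** — the same on EVEN four-tori for `01`-plane squares (module 4; `m·δ·b² ≤ ½`,
  `≤ exp(((C∕2)·b² − δβε)·#Q)`).

HONEST FRAMING.  Bare Wilson measure, decimation block map (coarse plaquette = `b × b` loop); NOT Bałaban's smeared `avOfRecord`, NOT conditional
on a small-field history (module 1's residuals (i), (ii) unchanged), NOT the count of NE7b (which banks these rates along RENEWAL histories — N12∕N13's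
window and the cell's `T4WeightBudget`).  NE7b NOT PRINTED ∕ NOT PROVED; (α)-instance 0∕1; N20 NOT discharged; typed 28∕28, discharged count
untouched; one finite four-torus at fixed `ε` — NOT ℝ⁴, NOT infinite volume, NOT OS, NOT a mass gap, NOT Clay.
-/

set_option autoImplicit false

noncomputable section

namespace Summit.QuantumFields.YangMills.BalabanUVNodes.N20LCSCoarseSparseness

open MeasureTheory
open Literature.MathematicalPhysics.QuantumFieldTheory
open Summit.QuantumFields.BalabanUV.T4Continuum.NE7b.LocalPlaquetteExpMoments (integrable_exp_of_abs_le)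
open Summit.QuantumFields.YangMills.Theorems.FemtoCurvatureTwoPointC.LatticeStokes (sub_re_trace_map_nonneg)
open Summit.QuantumFields.YangMills.BalabanUVNodes.N20LCSLoopEnergies (localExpMoment_loopEnergies localExpMoment_blockSquares)
open Summit.QuantumFields.YangMills.BalabanUVNodes.N20LCSLoopEnergiesEven (localExpMoment_blockSquares_even01)

/-! ## §1 Measurability of loop energies; the Markov–Chebyshev step -/

section Measurability

variable {d L N : ℕ} {G : Type} [Group G] [TopologicalSpace G] [MeasurableSpace G] [BorelSpace G]
  {τ : G →* Matrix (Fin N) (Fin N) ℂ}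

/-- **The energy of a rectangular Wilson loop is measurable**: `U ↦ N − Re tr τ(hol ∂(R×T))`. [folklore] -/
theorem measurable_loopEnergy [IsTopologicalGroup G] (hτ : Continuous τ) (x : Site d L) (i j : Fin d) (R T : ℕ) :
    Measurable fun U : GaugeConfig d L G => (N : ℝ) - (τ (rectangleHolonomy U x i j R T)).trace.re := by
  refine measurable_const.sub ?_
  unfold rectangleHolonomy
  exact ((((entryMeasurable_lineHolonomy hτ i R x).mul (entryMeasurable_lineHolonomy hτ j T _)).mul
    (entryMeasurable_lineHolonomy_inv hτ i R _)).mul (entryMeasurable_lineHolonomy_inv hτ j T _)).measurable_trace_re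

end Measurability

section Markov

variable {Ω : Type*} [MeasurableSpace Ω] (μ : Measure Ω) [IsProbabilityMeasure μ]

/-- **THE MARKOV–CHEBYSHEV STEP.**  For observables `A_P` (`P ∈ Q`), a threshold `ε`, tilts `δ, β ≥ 0` and an integrable exponential
`f = exp(δβ·Σ_{P∈Q} A_P)`: `μ{ω | ∀ P ∈ Q, ε ≤ A_P ω} ≤ (∫ f dμ) · exp(−δβε·#Q)` — on the event `δβε·#Q ≤ δβ·Σ_P A_P`, then Markov.
[folklore] -/
theorem measureReal_forall_le_le_of_expMoment {κ : Type*} (Q : Finset κ) (A : κ → Ω → ℝ) {ε δ β : ℝ} (hδ : 0 ≤ δ) (hβ : 0 ≤ β)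
    (hint : Integrable (fun ω => Real.exp (δ * β * ∑ P ∈ Q, A P ω)) μ) :
    μ.real {ω | ∀ P ∈ Q, ε ≤ A P ω} ≤
      (∫ ω, Real.exp (δ * β * ∑ P ∈ Q, A P ω) ∂μ) * Real.exp (-(δ * β * ε * Q.card)) := by
  set f : Ω → ℝ := fun ω => Real.exp (δ * β * ∑ P ∈ Q, A P ω) with hf
  set t : ℝ := Real.exp (δ * β * ε * Q.card) with ht
  have htpos : 0 < t := Real.exp_pos _
  -- the event is contained in `{t ≤ f}`
  have hsub : {ω | ∀ P ∈ Q, ε ≤ A P ω} ⊆ {ω | t ≤ f ω} := by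
    intro ω hω
    simp only [Set.mem_setOf_eq] at hω ⊢
    refine Real.exp_le_exp.2 ?_
    have hsum : ε * Q.card ≤ ∑ P ∈ Q, A P ω := by
      calc ε * Q.card = ∑ _P ∈ Q, ε := by rw [Finset.sum_const, nsmul_eq_mul, mul_comm]
        _ ≤ ∑ P ∈ Q, A P ω := Finset.sum_le_sum fun P hP => hω P hP
    have hδβ : 0 ≤ δ * β := mul_nonneg hδ hβ
    calc δ * β * ε * Q.card = δ * β * (ε * Q.card) := by ring
      _ ≤ δ * β * ∑ P ∈ Q, A P ω := mul_le_mul_of_nonneg_left hsum hδβ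
  -- Markov for the non-negative integrable `f`
  have hmarkov := mul_meas_ge_le_integral_of_nonneg (μ := μ) (ae_of_all _ fun ω => (Real.exp_pos _).le) hint t
  have h1 : μ.real {ω | ∀ P ∈ Q, ε ≤ A P ω} ≤ μ.real {ω | t ≤ f ω} := measureReal_mono hsub
  have h2 : μ.real {ω | t ≤ f ω} ≤ (∫ ω, f ω ∂μ) / t := by
    rw [le_div_iff₀ htpos, mul_comm]
    exact hmarkov
  calc μ.real {ω | ∀ P ∈ Q, ε ≤ A P ω} ≤ (∫ ω, f ω ∂μ) / t := h1.trans h2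
    _ = (∫ ω, f ω ∂μ) * Real.exp (-(δ * β * ε * Q.card)) := by rw [ht, Real.exp_neg, div_eq_mul_inv]

end Markov

/-! ## §2 Coarse large-field sparseness on odd four-tori -/

section Odd

variable {G : Type} [Group G] [TopologicalSpace G] [IsTopologicalGroup G] [CompactSpace G]
  [MeasurableSpace G] [BorelSpace G]

omit [MeasurableSpace G] [BorelSpace G] in
/-- `0 ≤ N − Re tr r(g) ≤ 2N` for a lattice representation (unitary values). [folklore] -/
theorem loopEnergy_bounds (r : LatticeRep G) (g : G) :
    0 ≤ (r.N : ℝ) - (r.ρ g).trace.re ∧ (r.N : ℝ) - (r.ρ g).trace.re ≤ 2 * r.N := by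
  refine ⟨sub_re_trace_map_nonneg r.ρ r.mem_unitary g, ?_⟩
  have h := Literature.RepresentationTheory.CompactGroups.CompactGroup.abs_re_trace_le_card r.ρ r.continuous g
  have h' : |(r.ρ g).trace.re| ≤ r.N := by simpa using h
  have := (abs_le.1 h').1
  linarith

/-- The tilted sum of loop energies of a finite family is a bounded measurable observable, hence has an integrable exponential under the
Wilson measure. [folklore] -/
theorem integrable_exp_sum_loopEnergy (r : LatticeRep G) {L : ℕ} [NeZero L] (β t : ℝ) {κ : Type*} (Q : Finset κ)
    (x : κ → Site 4 L) (μ ν : κ → Fin 4) (R T : κ → ℕ) :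
    Integrable (fun U : GaugeConfig 4 L G =>
        Real.exp (t * ∑ P ∈ Q, ((r.N : ℝ) - (r.ρ (rectangleHolonomy U (x P) (μ P) (ν P) (R P) (T P))).trace.re)))
      (wilsonMeasure r.ρ β : Measure (GaugeConfig 4 L G)) := by
  refine integrable_exp_of_abs_le r.ρ r.continuous β
    ((Finset.measurable_sum Q fun P _ => measurable_loopEnergy r.continuous (x P) (μ P) (ν P) (R P) (T P)).const_mul t)
    (B := |t| * (2 * r.N * Q.card)) fun U => ?_
  rw [abs_mul]
  refine mul_le_mul_of_nonneg_left ?_ (abs_nonneg _)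
  rw [abs_of_nonneg (Finset.sum_nonneg fun P _ => (loopEnergy_bounds r _).1)]
  calc ∑ P ∈ Q, ((r.N : ℝ) - (r.ρ (rectangleHolonomy U (x P) (μ P) (ν P) (R P) (T P))).trace.re)
      ≤ ∑ _P ∈ Q, (2 * (r.N : ℝ)) := Finset.sum_le_sum fun P _ => (loopEnergy_bounds r _).2
    _ = 2 * r.N * Q.card := by rw [Finset.sum_const, nsmul_eq_mul]; ring

/-- **COARSE LARGE-FIELD SPARSENESS FOR WILSON LOOPS (odd four-tori).**  With the constant `C` of `localExpMoment`: for every odd four-torus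
`(ℤ∕(2S+1))⁴` (`S ≥ 1`), every `β ≥ 4`, every finite family of rectangular loops `P ∈ Q` (base points `x P`, planes `μ P < ν P`, sides
`≤ 2S+1`, area `≤ 𝔞`) with plaquette regions `F P ⊇ face P` of size `≤ n` and multiplicity `≤ m`, every `δ ≥ 0` with `m·δ·𝔞 ≤ 1∕12`, and every
threshold `ε`: `μ_β{U | ∀ P ∈ Q, ε ≤ N − Re tr r(hol ∂P)} ≤ exp(((C∕12)·n − δ·β·ε)·#Q)`.  Module 2's loop-energy moment bound × the
Markov–Chebyshev step. [folklore] -/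
theorem coarseLargeFieldSparse_loops (r : LatticeRep G) :
    ∃ C : ℝ, 0 ≤ C ∧ ∀ (S : ℕ), 1 ≤ S → ∀ (β : ℝ), 4 ≤ β →
      ∀ (κ : Type) (Q : Finset κ) (x : κ → Site 4 (2 * S + 1)) (μ ν : κ → Fin 4) (hμν : ∀ P, μ P < ν P)
        (R T : κ → ℕ) (F : κ → Finset (Plaquette 4 (2 * S + 1))) (𝔞 m n : ℕ) (δ ε : ℝ),
        0 ≤ δ → (m : ℝ) * (δ * 𝔞) ≤ 1 / 12 →
        (∀ P ∈ Q, R P ≤ 2 * S + 1) → (∀ P ∈ Q, T P ≤ 2 * S + 1) → (∀ P ∈ Q, R P * T P ≤ 𝔞) →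
        (∀ P ∈ Q, (Finset.range (R P) ×ˢ Finset.range (T P)).image (fun st : ℕ × ℕ =>
            ((x P + Pi.single (μ P) (st.1 : ZMod (2 * S + 1)) + Pi.single (ν P) (st.2 : ZMod (2 * S + 1)),
              ⟨(μ P, ν P), hμν P⟩) : Plaquette 4 (2 * S + 1))) ⊆ F P) →
        (∀ q ∈ Q.biUnion F, (Q.filter fun P => q ∈ F P).card ≤ m) → (∀ P ∈ Q, (F P).card ≤ n) →
        (wilsonMeasure r.ρ β : Measure (GaugeConfig 4 (2 * S + 1) G)).real
            {U | ∀ P ∈ Q, ε ≤ (r.N : ℝ) - (r.ρ (rectangleHolonomy U (x P) (μ P) (ν P) (R P) (T P))).trace.re} ≤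
          Real.exp ((C / 12 * n - δ * β * ε) * Q.card) := by
  obtain ⟨C, hC0, hC⟩ := localExpMoment_loopEnergies r
  refine ⟨C, hC0, fun S hS β hβ κ Q x μ ν hμν R T F 𝔞 m n δ ε hδ hsmall hR hT hA hF hmult hn => ?_⟩
  haveI hprob := isProbabilityMeasure_wilsonMeasure (d := 4) (L := 2 * S + 1) (G := G) r.ρ r.continuous β
  have hβ0 : 0 ≤ β := by linarith
  have hmom := hC S hS β hβ κ Q x μ ν hμν R T F 𝔞 m n δ hδ hsmall hR hT hA hF hmult hn
  have hint := integrable_exp_sum_loopEnergy r β (δ * β) Q x μ ν R T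
  have hmk := measureReal_forall_le_le_of_expMoment (wilsonMeasure r.ρ β : Measure (GaugeConfig 4 (2 * S + 1) G)) Q
    (fun P U => (r.N : ℝ) - (r.ρ (rectangleHolonomy U (x P) (μ P) (ν P) (R P) (T P))).trace.re) (ε := ε) hδ hβ0 hint
  refine hmk.trans ?_
  calc (∫ U, Real.exp (δ * β * ∑ P ∈ Q, ((r.N : ℝ) - (r.ρ (rectangleHolonomy U (x P) (μ P) (ν P) (R P) (T P))).trace.re))
          ∂(wilsonMeasure r.ρ β : Measure (GaugeConfig 4 (2 * S + 1) G))) * Real.exp (-(δ * β * ε * Q.card))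
      ≤ Real.exp (C / 12 * (n * Q.card)) * Real.exp (-(δ * β * ε * Q.card)) :=
        mul_le_mul_of_nonneg_right hmom (Real.exp_pos _).le
    _ = Real.exp ((C / 12 * n - δ * β * ε) * Q.card) := by rw [← Real.exp_add]; ring_nf

/-- **COARSE LARGE-FIELD SPARSENESS FOR THE DECIMATED FIELD (odd four-tori).**  For every finite family of `b × b` squares (the coarse
plaquettes of the side-`b` decimation; base points `x P`, planes `μ P < ν P`, `b ≤ 2S+1`) whose faces have multiplicity `≤ m`, every `δ ≥ 0`
with `m·δ·b² ≤ 1∕12` and every threshold `ε`: `μ_β{U | ∀ P ∈ Q, ε ≤ N − Re tr r(hol ∂P)} ≤ exp(((C∕12)·b² − δ·β·ε)·#Q)` for every `β ≥ 4`,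
uniformly in the volume — a prescribed set of `ε`-large COARSE plaquettes is jointly exponentially rare in `β` (rate `δε` per plaquette once
`β > C b²∕(12δε)`): the scale-1 twin, for decimation, of the tree's rung-0 `largeFieldSparse`. [folklore] -/
theorem coarseLargeFieldSparse_blockSquares (r : LatticeRep G) :
    ∃ C : ℝ, 0 ≤ C ∧ ∀ (S : ℕ), 1 ≤ S → ∀ (β : ℝ), 4 ≤ β →
      ∀ (κ : Type) (Q : Finset κ) (x : κ → Site 4 (2 * S + 1)) (μ ν : κ → Fin 4) (hμν : ∀ P, μ P < ν P)
        (b m : ℕ) (δ ε : ℝ), 0 ≤ δ → (m : ℝ) * (δ * ((b * b : ℕ) : ℝ)) ≤ 1 / 12 → b ≤ 2 * S + 1 →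
        (∀ q ∈ Q.biUnion (fun P => (Finset.range b ×ˢ Finset.range b).image (fun st : ℕ × ℕ =>
            ((x P + Pi.single (μ P) (st.1 : ZMod (2 * S + 1)) + Pi.single (ν P) (st.2 : ZMod (2 * S + 1)),
              ⟨(μ P, ν P), hμν P⟩) : Plaquette 4 (2 * S + 1)))),
          (Q.filter fun P => q ∈ (Finset.range b ×ˢ Finset.range b).image (fun st : ℕ × ℕ =>
            ((x P + Pi.single (μ P) (st.1 : ZMod (2 * S + 1)) + Pi.single (ν P) (st.2 : ZMod (2 * S + 1)),
              ⟨(μ P, ν P), hμν P⟩) : Plaquette 4 (2 * S + 1)))).card ≤ m) →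
        (wilsonMeasure r.ρ β : Measure (GaugeConfig 4 (2 * S + 1) G)).real
            {U | ∀ P ∈ Q, ε ≤ (r.N : ℝ) - (r.ρ (rectangleHolonomy U (x P) (μ P) (ν P) b b)).trace.re} ≤
          Real.exp ((C / 12 * (b * b : ℕ) - δ * β * ε) * Q.card) := by
  obtain ⟨C, hC0, hC⟩ := localExpMoment_blockSquares r
  refine ⟨C, hC0, fun S hS β hβ κ Q x μ ν hμν b m δ ε hδ hsmall hb hmult => ?_⟩
  haveI hprob := isProbabilityMeasure_wilsonMeasure (d := 4) (L := 2 * S + 1) (G := G) r.ρ r.continuous β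
  have hβ0 : 0 ≤ β := by linarith
  have hmom := hC S hS β hβ κ Q x μ ν hμν b m δ hδ hsmall hb hmult
  have hint := integrable_exp_sum_loopEnergy r β (δ * β) Q x μ ν (fun _ => b) (fun _ => b)
  have hmk := measureReal_forall_le_le_of_expMoment (wilsonMeasure r.ρ β : Measure (GaugeConfig 4 (2 * S + 1) G)) Q
    (fun P U => (r.N : ℝ) - (r.ρ (rectangleHolonomy U (x P) (μ P) (ν P) b b)).trace.re) (ε := ε) hδ hβ0 hint
  refine hmk.trans ?_
  calc (∫ U, Real.exp (δ * β * ∑ P ∈ Q, ((r.N : ℝ) - (r.ρ (rectangleHolonomy U (x P) (μ P) (ν P) b b)).trace.re))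
          ∂(wilsonMeasure r.ρ β : Measure (GaugeConfig 4 (2 * S + 1) G))) * Real.exp (-(δ * β * ε * Q.card))
      ≤ Real.exp (C / 12 * ((b * b : ℕ) * Q.card)) * Real.exp (-(δ * β * ε * Q.card)) :=
        mul_le_mul_of_nonneg_right hmom (Real.exp_pos _).le
    _ = Real.exp ((C / 12 * (b * b : ℕ) - δ * β * ε) * Q.card) := by rw [← Real.exp_add]; ring_nf

end Odd

/-! ## §3 Coarse large-field sparseness on even four-tori, `01`-plane -/

section Even

variable {G : Type} [Group G] [TopologicalSpace G] [IsTopologicalGroup G] [CompactSpace G]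
  [MeasurableSpace G] [BorelSpace G]

/-- **COARSE LARGE-FIELD SPARSENESS FOR THE DECIMATED FIELD, EVEN FOUR-TORI, `01`-PLANE.**  With the constant `C` of
`localExpMoment_class01_even`: for every even four-torus `(ℤ∕L)⁴`, every `β ≥ 4`, every finite family of `b × b` squares in the `(0,1)`-plane
(`b ≤ L`) whose face site sets have multiplicity `≤ m`, every `δ ≥ 0` with `m·δ·b² ≤ ½` and every threshold `ε`:
`μ_β{U | ∀ P ∈ Q, ε ≤ N − Re tr r(hol ∂P)} ≤ exp(((C∕2)·b² − δ·β·ε)·#Q)`. [folklore] -/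
theorem coarseLargeFieldSparse_blockSquares_even01 (r : LatticeRep G) :
    ∃ C : ℝ, 0 ≤ C ∧ ∀ (L : ℕ) [NeZero L], Even L → ∀ (β : ℝ), 4 ≤ β →
      ∀ (κ : Type) (Q : Finset κ) (x : κ → Site 4 L) (b m : ℕ) (δ ε : ℝ),
        0 ≤ δ → (m : ℝ) * (δ * ((b * b : ℕ) : ℝ)) ≤ 1 / 2 → b ≤ L →
        (∀ y ∈ Q.biUnion (fun P => (Finset.range b ×ˢ Finset.range b).image
            (fun st : ℕ × ℕ => (x P + Pi.single 0 (st.1 : ZMod L) + Pi.single 1 (st.2 : ZMod L) : Site 4 L))),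
          (Q.filter fun P => y ∈ (Finset.range b ×ˢ Finset.range b).image
            (fun st : ℕ × ℕ => (x P + Pi.single 0 (st.1 : ZMod L) + Pi.single 1 (st.2 : ZMod L) : Site 4 L))).card ≤ m) →
        (wilsonMeasure r.ρ β : Measure (GaugeConfig 4 L G)).real
            {U | ∀ P ∈ Q, ε ≤ (r.N : ℝ) - (r.ρ (rectangleHolonomy U (x P) 0 1 b b)).trace.re} ≤
          Real.exp ((C / 2 * (b * b : ℕ) - δ * β * ε) * Q.card) := by
  obtain ⟨C, hC0, hC⟩ := localExpMoment_blockSquares_even01 r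
  refine ⟨C, hC0, fun L _ hL β hβ κ Q x b m δ ε hδ hsmall hb hmult => ?_⟩
  haveI hprob := isProbabilityMeasure_wilsonMeasure (d := 4) (L := L) (G := G) r.ρ r.continuous β
  have hβ0 : 0 ≤ β := by linarith
  have hmom := hC L hL β hβ κ Q x b m δ hδ hsmall hb hmult
  have hint := integrable_exp_sum_loopEnergy r β (δ * β) Q x (fun _ => 0) (fun _ => 1) (fun _ => b) (fun _ => b)
  have hmk := measureReal_forall_le_le_of_expMoment (wilsonMeasure r.ρ β : Measure (GaugeConfig 4 L G)) Q
    (fun P U => (r.N : ℝ) - (r.ρ (rectangleHolonomy U (x P) 0 1 b b)).trace.re) (ε := ε) hδ hβ0 hint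
  refine hmk.trans ?_
  calc (∫ U, Real.exp (δ * β * ∑ P ∈ Q, ((r.N : ℝ) - (r.ρ (rectangleHolonomy U (x P) 0 1 b b)).trace.re))
          ∂(wilsonMeasure r.ρ β : Measure (GaugeConfig 4 L G))) * Real.exp (-(δ * β * ε * Q.card))
      ≤ Real.exp (C / 2 * ((b * b : ℕ) * Q.card)) * Real.exp (-(δ * β * ε * Q.card)) :=
        mul_le_mul_of_nonneg_right hmom (Real.exp_pos _).le
    _ = Real.exp ((C / 2 * (b * b : ℕ) - δ * β * ε) * Q.card) := by rw [← Real.exp_add]; ring_nf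

end Even

end Summit.QuantumFields.YangMills.BalabanUVNodes.N20LCSCoarseSparseness

end
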